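import Literature.AnabelianGeometry.EtaleTheta.Discharge.Sec2Prop22iOfCoverData

/-!
# [EtTh] Prop 2.2 (ii), clause «Δ_X̲̲ maps isomorphically onto Δ̄^ell_X̲ [hence is a cyclic group of order l]»
# over the BARE interface `CoverData`, for EVERY odd `l` (proof-only companion)

Mochizuki, *The Étale Theta Function …* [EtTh], Publ. RIMS **45** (2009), §2, Prop. 2.2 (ii), PRIMS printed
p. 263 (= PDF p. 37), ll. 22–24: "Here, the 'geometric portion' `Δ_X̲̲` of `Π_X̲̲` maps isomorphically onto
`Δ̄^ell_X̲` [hence is a cyclic group of order `l`], i.e., we have `Δ_X̲̲ = Im(s_ι)`, `Δ̄_X̲ = Δ_X̲̲ · Δ̄_Θ`"; bib key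
`MochizukiEtTh2009`. PROOF-ONLY companion (no `def`, nothing restated) of `ThetaCovers.lean` (abc-iut-L2-t2),
sixth of the bare-interface series of seat abc-iut-w6-d082 (cell abc-iut, block C / W6, node `EtTh:Prop2.2(ii)`;
clause C of HOME/plan/C-CLAUSES-L2A.md). It upgrades the two index-level renderings of
`Sec2Prop22iiOfCoverData.lean` (p431949: `relIndex_barKer_eigen` "[E : Ker] = l", `isCyclic_eigen_quot` for
PRIME `l`) to the literal clause for every odd `l`:

* `CoverData.barTheta_subgroupOf_eigen` — inside `E`, the `Δ̄_Θ`-preimage and `Ker` cut out the same subgroup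
  (`E ∩ Δ̄_Θ-preimage = Ker`);
* `CoverData.nonempty_eigenQuot_mulEquiv` — **"`Δ_X̲̲` maps isomorphically onto `Δ̄^ell_X̲`"**:
  `E / Ker ≃* Δ_X̲ / Δ̄_Θ-preimage` (Noether's second isomorphism theorem at `E · Δ̄_Θ-preimage = Δ_X̲`);
* `CoverData.isCyclic_deltaXu_quot` — `Δ̄^ell_X̲ = Δ_X̲ / Δ̄_Θ-preimage` is CYCLIC for every odd `l` (the kernel of a
  surjection `(ℤ/l)² ↠ ℤ/l`; `CoverData.exists_generator_mod_barTheta`, p433698);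
* `CoverData.isCyclic_eigen_quot_odd` — **"[hence is a cyclic group of order `l`]"** for every odd `l`
  (order `l`: `relIndex_barKer_eigen`, p431949).

Nothing here asserts that `CoverData` is inhabited by an actual curve; no side is taken on [IUTchIII] Cor. 3.12;
typed ≠ proved elsewhere.
-/

namespace Literature.AnabelianGeometry.EtaleTheta.ThetaCovers.CoverData

universe u

variable {l : ℕ} (X : CoverData.{u} l)

/-- Inside the `(−1)`-eigenspace `E`, the `Δ̄_Θ`-preimage and `Ker(Δ_X ↠ Δ̄_X)` cut out the same subgroup
(`E ∩ Δ̄_Θ-preimage = Ker ⊆ Δ̄_Θ-preimage`). [cite: MochizukiEtTh2009, Prop 2.2(i) p.37] -/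
theorem barTheta_subgroupOf_eigen {H H' E : Subgroup X.PiC} {ι : X.PiC} (hE : X.IsMinusEigen H H' ι E) :
    X.barTheta.subgroupOf E = X.barKer.subgroupOf E := by
  ext e
  rw [Subgroup.mem_subgroupOf, Subgroup.mem_subgroupOf]
  constructor
  · intro h
    have : (e : X.PiC) ∈ E ⊓ X.barTheta := ⟨e.2, h⟩
    rwa [hE.inf_eq] at this
  · exact fun h => X.barKer_le_barTheta h

/-- `Δ̄_Θ-preimage ∩ Δ_X̲` is normal in `Δ_X̲` (indeed the `Δ̄_Θ`-preimage is normal in `Π_C`); recorded so that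
`Δ̄^ell_X̲ = Δ_X̲ / Δ̄_Θ-preimage` is a group. [cite: MochizukiEtTh2009, Def 2.1 p.36] -/
theorem normal_barTheta_subgroupOf (K : Subgroup X.PiC) : (X.barTheta.subgroupOf K).Normal := by
  haveI := X.barTheta_normal
  infer_instance

/-- **Prop 2.2 (ii): "the geometric portion `Δ_X̲̲` of `Π_X̲̲` maps isomorphically onto `Δ̄^ell_X̲`"**, over the bare
interface and for every odd `l`: `E / Ker ≃* Δ_X̲ / Δ̄_Θ-preimage`, where `E = Im(s_ι)`-preimage `= Δ_X̲̲` (by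
`splitting_sup_eigen_inf_deltaC`) and `Δ_X̲ = H ∩ Δ_C` — Noether's second isomorphism theorem for `E` and the normal
`Δ̄_Θ`-preimage, with `E ∩ Δ̄_Θ-preimage = Ker` and `E · Δ̄_Θ-preimage = Δ_X̲`. (The instance arguments are
`X.normal_barKer_subgroupOf E`, `X.normal_barTheta_subgroupOf _`.) [cite: MochizukiEtTh2009, Prop 2.2(ii) p.37] -/
theorem nonempty_eigenQuot_mulEquiv {H H' E : Subgroup X.PiC} {ι : X.PiC}
    [(X.barKer.subgroupOf E).Normal] [(X.barTheta.subgroupOf (H ⊓ X.DeltaC)).Normal]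
    (hE : X.IsMinusEigen H H' ι E) :
    Nonempty (↥E ⧸ X.barKer.subgroupOf E ≃* ↥(H ⊓ X.DeltaC) ⧸ X.barTheta.subgroupOf (H ⊓ X.DeltaC)) := by
  haveI := X.barTheta_normal
  haveI := X.barKer_normal
  have e1 : ↥E ⧸ X.barKer.subgroupOf E ≃* ↥E ⧸ X.barTheta.subgroupOf E :=
    QuotientGroup.quotientMulEquivOfEq (X.barTheta_subgroupOf_eigen hE).symm
  have e2 : ↥E ⧸ X.barTheta.subgroupOf E ≃* ↥(E ⊔ X.barTheta) ⧸ X.barTheta.subgroupOf (E ⊔ X.barTheta) :=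
    QuotientGroup.quotientInfEquivProdNormalQuotient E X.barTheta
  have e3 : ↥(E ⊔ X.barTheta) ⧸ X.barTheta.subgroupOf (E ⊔ X.barTheta) ≃*
      ↥(H ⊓ X.DeltaC) ⧸ X.barTheta.subgroupOf (H ⊓ X.DeltaC) :=
    QuotientGroup.equivQuotientSubgroupOfOfEq rfl hE.sup_eq
  exact ⟨(e1.trans e2).trans e3⟩

/-- **`Δ̄^ell_X̲ = Δ_X̲ / Δ̄_Θ-preimage` is CYCLIC**, over the bare interface and for every odd `l` (it is the kernel of a
surjection `(ℤ/l)² ↠ ℤ/l`: `CoverData.exists_generator_mod_barTheta`). (The instance argument is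
`X.normal_barTheta_subgroupOf _`.) [cite: MochizukiEtTh2009, Prop 2.2(ii) p.37] -/
theorem isCyclic_deltaXu_quot {H : Subgroup X.PiC} [(X.barTheta.subgroupOf (H ⊓ X.DeltaC)).Normal]
    (hT : X.IsTypeLTors H) : IsCyclic (↥(H ⊓ X.DeltaC) ⧸ X.barTheta.subgroupOf (H ⊓ X.DeltaC)) := by
  obtain ⟨g, hgH, hgΔ, hgen⟩ := X.exists_generator_mod_barTheta hT
  have hgD : g ∈ H ⊓ X.DeltaC := ⟨hgH, hgΔ.2⟩
  refine ⟨⟨QuotientGroup.mk ⟨g, hgD⟩, fun q => ?_⟩⟩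
  induction q using QuotientGroup.induction_on with
  | H d =>
    obtain ⟨k, t, ht, hd⟩ := hgen d d.2.1 ⟨hT.le d.2.1, d.2.2⟩
    refine ⟨k, ?_⟩
    change (QuotientGroup.mk (⟨g, hgD⟩ : ↥(H ⊓ X.DeltaC))) ^ k = QuotientGroup.mk d
    rw [← QuotientGroup.mk_zpow, QuotientGroup.eq, Subgroup.mem_subgroupOf, Subgroup.coe_mul,
      Subgroup.coe_inv, Subgroup.coe_zpow, hd]
    change (g ^ k)⁻¹ * (g ^ k * t) ∈ X.barTheta
    rw [inv_mul_cancel_left]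
    exact ht

/-- **Prop 2.2 (ii): "[hence `Δ_X̲̲` is a cyclic group of order `l`]"**, over the bare interface and for EVERY odd
`l`: `E / Ker` is cyclic (order `l` by `relIndex_barKer_eigen`, p431949). Supersedes the prime-`l` form
`isCyclic_eigen_quot`. (The instance argument is `X.normal_barKer_subgroupOf E`.)
[cite: MochizukiEtTh2009, Prop 2.2(ii) p.37] -/
theorem isCyclic_eigen_quot_odd {H H' E : Subgroup X.PiC} {ι : X.PiC} [(X.barKer.subgroupOf E).Normal]
    (hH' : X.IsTypeLTorsPm H') (hH : H = H' ⊓ X.PiX) (hE : X.IsMinusEigen H H' ι E) :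
    IsCyclic (↥E ⧸ X.barKer.subgroupOf E) := by
  haveI := X.normal_barTheta_subgroupOf (H ⊓ X.DeltaC)
  have hT : X.IsTypeLTors H := by rw [hH]; exact hH'.inf_isTypeLTors
  haveI := X.isCyclic_deltaXu_quot hT
  obtain ⟨e⟩ := X.nonempty_eigenQuot_mulEquiv hE
  exact isCyclic_of_surjective e.symm e.symm.surjective

end Literature.AnabelianGeometry.EtaleTheta.ThetaCovers.CoverData
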